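import Summits.AnomalousDissipation.AnomalousDissipation.Theorems.SolenoidalFractalHomogenisationLagrangianStepVmodDistortedDefs
import Summits.AnomalousDissipation.AnomalousDissipation.Theorems.SolenoidalFractalHomogenisationLagrangianStepZ7GlueDefs
import HarnessLib

/-!
# K1L_D (stmt-AnomalousDissipation-27980), (ℓ3-A) road A: the (ℓ3)-internal vocabulary over the CLASS OF RECORD `IsFrameModulation`
# (holonomic · clamped · rate-bounded modulation data) — TEXTS OF RECORD (tenure RULING D28-10 (a); certifier 3-probe PASS of
# `Cruxes/…/Lines/onelevel_L21_texts.lean` ad9ea4cc51d6; memo L21 `Cruxes/…/Lines/onelevel-L21-ell3A-recut.md`; prover lead-k1l-onelevel-p1 g7)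
(Summits-side definitions file of route `SolenoidalFractalHomogenisation`; review lane.)

CONVENTION (D28-8′ line-1 rule): the tree's distortion is DERIVATIVE-INDEX — `Torus.Visc4.conj M 𝔸 i c j e = Σ_{a,b} M c a * 𝔸 i a j b * M e b`,
`Torus.viscAdjVar 𝔹 Ψ = Σ_j (Σ_{i,c,e} ∂_e(𝔹 i c j e · (∂_c Ψ)_i)) e_j`; the class variable is `v = u ∘ X`; `Torus.distort G v = G·v` enters ONLY the constraint.

WHY A NEW LEAF FILE and not amendments of `…CellClauseModDefs` / `…VmodDistortedDefs` / `…Z7GlueDefs` (D28-10 (a) wording): those three are imported by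
≈ every file of the (ℓ2)/(ℓ3)/§9z lanes; appending to them re-builds the whole cone on the farm (ops flags #1–#3 of 2026-08-29 on incoherent oleans) while
five seats are landing against them.  The declarations below are BYTE-IDENTICAL to §1–§2 of the 3-probed texts file, in the same namespaces; nothing existing
is touched.

ONE binder changes w.r.t. the landed texts (p711553 `…VmodDistortedDefs`, p694968 `…Z7GlueDefs`): `CellClauseMod.IsModulation θ Tw nC G ↦
CellClauseMod.IsFrameModulation θ Tw nC G`, a structure EXTENDING `IsModulation` by three fields, all FREE for the one instance ever instantiated — the
clamped exact-flow curve `τ ↦ frameG E m (jR + clamp(τ)/a) jR` (`FrameForm.isFrameModulation_frameG_closed_pos`, companion `…LagrangianStepFrameModulationF`):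
* `clamped`   — `G t = G (max 0 (min t Tw))`: the datum only takes its window values, so `piola`/`det_one`/`near_one`/`smooth`/`holonomic` hold at EVERY
                real time (the Lipschitz test class of `Torus.IsWeakTensorPassiveVectorDistortedOn` needs it: admissible tests with `Ψ 0 ≠ 0` are nonzero
                at small negative times);
* `rate`      — (R-d) pointwise RATE `|G t₂ y i j − G t₁ y i j| ≤ (θ/Tw)·|t₂ − t₁|` on `[0,Tw]` (linear onset from `G 0 = 1`; free strengthening, not
                load-bearing for (M_θ) — certifier toy j331120);
* `holonomic` — FRAME STRUCTURE `G t y * (1 + ∇φ_t(y)) = 1` for a smooth periodic displacement `φ_t` (product form: no inverse, no flow in the type):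
                the columns of `G` are COMMUTING coordinate fields (Schwarz), so the transverse-invisible tensors (the `(a,b)`-antisymmetric family incl.
                null Lagrangians, and the trace families) are invisible to the distorted weak class — certifier gap G1 closed by typing (RULINGS D28-8′
                (T-b), D28-8‴: NO `FullBound` binder anywhere; canonicalisation is a DEVICE inside proofs, Literature tools T♮0/T♮1/T♮2).
Everything else — binder order, constants, the error functional, `IsSlow`/`IsFast`, the propagator spec `IsDistortedPropagator` — VERBATIM.
D28-9 CONDITION (grid-phase): like `SlowVectorClauseModECW0`, every text here is RESET-ANCHORED (`U 0 t`, `T 0 t`, classes of the data at the reset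
where `G 0 = 1`); the flat (ℓ2) inputs of the future block proofs are therefore the `s = 0` / grid-phase instances (`…VmodFlatBlocksP` family of D28-9).
v2 (D28-10 (c), approved in advance): `IsDistortedPropagator ↦ IsDistortedPropagatorS := … ∧ exists_sol` once the converse reading lemma lands; until then
block helpers take `exists_sol` as a local hypothesis spelled identically.

Contents: §1 `CellClauseMod.IsFrameModulation` (+ `isFrameModulation_one`, `piola_all`, `smooth_all`, `abs_sub_one_le_rate_mul`); §2 `VmodDist.SlowVectorClauseModECW0F`,
`BlockBoundGF`, `NearMultGF` + the weakenings `modECW0F_of_modECW0`, `blockBoundGF_of_blockBoundG`, `nearMultGF_of_nearMultG`; §3 `Z7Glue.FrameConjugacyAtF`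
(`FrameConjugacyAt` VERBATIM with the frame-modulation datum) + `FrameConjugacyAtF.toFrameConjugacyAt`.
Companions (proof files): `…VmodFrameAssembly` (`modECW0F_of_blockBoundsGF_at`), `…FrameModulationF` (frame instance), `…FrameConjugacyF` (providers),
`…Z7GlueEulerXOfVRH0F` (`vmod_EX_of_VRH0F` — the by-name road of `stub_Vmod_EHTthg` over the class of record; NO registry move, v28 stands).
Definitions + trivial bridges only; NOT a proof of (M_θ), of any block, of `stub_Vmod_EHTthg`, of K1L_D or of AD; rung F-D1.A0.
-/

set_option linter.dupNamespace false

noncomputable section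

namespace Summit.AnomalousDissipation.AnomalousDissipation.Theorems.SolenoidalFractalHomogenisation.LagrangianStep.CellClauseMod

open Literature.Analysis Literature.Analysis.FluidPDE Literature.Analysis.FunctionSpaces
open MeasureTheory Set Filter UnitAddTorus
open scoped ENNReal NNReal InnerProductSpace

/-! ## §1 The class of record: holonomic, clamped, rate-bounded modulation data -/

/-- **`IsFrameModulation θ Tw nC G` — the CLASS OF RECORD of the (ℓ3) line (RULING D28-8′ (T-b) ∧ (R-d)).**  A modulation datum
(`IsModulation`: `G 0 = 1`, `|G − 1| ≤ θ`, `det = 1`, Piola columns, smooth, `|∇G| ≤ θ·nC`, Lipschitz, `∫|∂_t G| ≤ θ`) which moreover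
(i) is CLAMPED to its window (`G t = G (clamp t)`), (ii) has the pointwise RATE `θ/Tw` in cell time, and (iii) is HOLONOMIC: at every window time
`G t = (1 + ∇φ_t)⁻¹` for a smooth periodic displacement `φ_t : 𝕋³ → ℝ³` (the inverse Jacobian of the map `y ↦ y + φ_t(y)`), stated as the
product identity `G t y * (1 + ∇φ_t(y)) = 1` (no matrix inverse, no junk).  The only instance ever instantiated is the clamped exact-flow frame
`τ ↦ frameG E m (jR + clamp(τ)/a(m+1)) (jR)` of a template carrier (`φ = E.disp m · (jR)`). -/
structure IsFrameModulation (θ Tw nC : ℝ) (G : ℝ → UnitAddTorus (Fin 3) → Matrix (Fin 3) (Fin 3) ℝ) : Prop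
    extends IsModulation θ Tw nC G where
  /-- the datum only takes its window values -/
  clamped : ∀ t y, G t y = G (max 0 (min t Tw)) y
  /-- (R-d) pointwise rate `θ / Tw` in cell time, uniformly in `y` -/
  rate : ∀ y i j, ∀ t₁ ∈ Icc 0 Tw, ∀ t₂ ∈ Icc 0 Tw, |G t₂ y i j - G t₁ y i j| ≤ θ / Tw * |t₂ - t₁|
  /-- holonomic (frame) structure: `G t = (1 + ∇φ_t)⁻¹`, `φ_t` smooth periodic -/
  holonomic : ∀ t ∈ Icc 0 Tw, ∃ φ : UnitAddTorus (Fin 3) → EuclideanSpace ℝ (Fin 3), Torus.IsSmooth φ ∧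
    ∀ y, G t y * Matrix.of (fun a c => (1 : Matrix (Fin 3) (Fin 3) ℝ) a c + Torus.partialDeriv c (fun z => φ z a) y) = 1

/-- The identity is a frame modulation (θ = 0). -/
theorem isFrameModulation_one {Tw nC : ℝ} : IsFrameModulation 0 Tw nC (fun _ _ => (1 : Matrix (Fin 3) (Fin 3) ℝ)) where
  toIsModulation := isModulation_one
  clamped := fun _ _ => rfl
  rate := fun y i j t₁ _ t₂ _ => by simp
  holonomic := fun t _ => ⟨fun _ => 0, Torus.isSmooth_const _, fun y => by
    have h : Matrix.of (fun a c => (1 : Matrix (Fin 3) (Fin 3) ℝ) a c + Torus.partialDeriv c (fun _ : UnitAddTorus (Fin 3) => (0 : EuclideanSpace ℝ (Fin 3)) a) y)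
        = 1 := by
      ext a c
      rw [Matrix.of_apply, show (fun _ : UnitAddTorus (Fin 3) => (0 : EuclideanSpace ℝ (Fin 3)) a) = fun _ => (0:ℝ) from rfl,
        partialDeriv_const_fun, add_zero]
    rw [h, Matrix.one_mul]⟩

/-- Outside the window a clamped datum repeats its endpoint values; in particular ALL-TIME Piola: the columns of `G t` are divergence free at
every real time. -/
theorem IsFrameModulation.piola_all {θ Tw nC : ℝ} {G : ℝ → UnitAddTorus (Fin 3) → Matrix (Fin 3) (Fin 3) ℝ} (hG : IsFrameModulation θ Tw nC G)
    (hTw : 0 ≤ Tw) (t : ℝ) (i : Fin 3) :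
    Torus.IsDivFree (fun y => (WithLp.toLp 2 fun c => G t y c i : EuclideanSpace ℝ (Fin 3))) := by
  have hmem : max 0 (min t Tw) ∈ Icc 0 Tw := ⟨le_max_left _ _, max_le hTw (min_le_right _ _)⟩
  have h := hG.piola (max 0 (min t Tw)) hmem i
  have e : (fun y => (WithLp.toLp 2 fun c => G t y c i : EuclideanSpace ℝ (Fin 3)))
      = fun y => (WithLp.toLp 2 fun c => G (max 0 (min t Tw)) y c i : EuclideanSpace ℝ (Fin 3)) := by
    funext y; simp_rw [hG.clamped t y]
  rw [e]; exact h

/-- ALL-TIME smoothness of the entries of a clamped datum. -/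
theorem IsFrameModulation.smooth_all {θ Tw nC : ℝ} {G : ℝ → UnitAddTorus (Fin 3) → Matrix (Fin 3) (Fin 3) ℝ} (hG : IsFrameModulation θ Tw nC G)
    (hTw : 0 ≤ Tw) (t : ℝ) (i j : Fin 3) : Torus.IsSmooth (fun y => G t y i j) := by
  have hmem : max 0 (min t Tw) ∈ Icc 0 Tw := ⟨le_max_left _ _, max_le hTw (min_le_right _ _)⟩
  have e : (fun y => G t y i j) = fun y => G (max 0 (min t Tw)) y i j := funext fun y => by rw [hG.clamped t y]
  rw [e]; exact hG.smooth _ hmem i j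

/-- Linear onset: `|G t − 1| ≤ (θ/Tw)·t` on the window (rate + `G 0 = 1`). -/
theorem IsFrameModulation.abs_sub_one_le_rate_mul {θ Tw nC : ℝ} {G : ℝ → UnitAddTorus (Fin 3) → Matrix (Fin 3) (Fin 3) ℝ}
    (hG : IsFrameModulation θ Tw nC G) {t : ℝ} (ht : t ∈ Icc 0 Tw) (y : UnitAddTorus (Fin 3)) (i j : Fin 3) :
    |G t y i j - (1 : Matrix (Fin 3) (Fin 3) ℝ) i j| ≤ θ / Tw * t := by
  have h := hG.rate y i j 0 ⟨le_rfl, ht.1.trans ht.2⟩ t ht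
  rw [hG.init y, sub_zero, abs_of_nonneg ht.1] at h
  exact h

end Summit.AnomalousDissipation.AnomalousDissipation.Theorems.SolenoidalFractalHomogenisation.LagrangianStep.CellClauseMod

namespace Summit.AnomalousDissipation.AnomalousDissipation.Theorems.SolenoidalFractalHomogenisation.LagrangianStep.VmodDist

open Literature.Analysis Literature.Analysis.FluidPDE Literature.Analysis.FunctionSpaces
open MeasureTheory Set
open scoped InnerProductSpace
open Summit.AnomalousDissipation.AnomalousDissipation.Theorems.SolenoidalFractalHomogenisation.LagrangianStep.CellClauseMod
open Summit.AnomalousDissipation.AnomalousDissipation.Theorems.SolenoidalFractalHomogenisation.LagrangianStep.LossCurrency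
open Summit.AnomalousDissipation.AnomalousDissipation.Theorems.SolenoidalFractalHomogenisation.LagrangianStep.VmodFlat
  (IsSlow IsFast fc fc_sub inner_eq_zero_of_fc_disjoint eta_sum_le)

/-! ## §2 The (ℓ3)-internal texts over the class of record -/

/-- **(V_modECW0F)** — `SlowVectorClauseModECW0` VERBATIM except `IsModulation ↦ IsFrameModulation` (holonomic · clamped · rate `θ/Tw`).
[cite: ArmstrongVicol2025, §4.1 (PDF p. 34: the distortion-adapted comparison problem)] -/
def SlowVectorClauseModECW0F {k : ℕ} (W : LatticeShear.LatticeWord k) (M : ℝ) (hM : 0 < M) (c : ℝ)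
    (Φ : ℝ → Torus.Visc4 (Fin 3) → Torus.Visc4 (Fin 3)) (lo hi Λ β σ C ν₀ K θ₁ ϱ₁ : ℝ) : Prop :=
  ∀ ν, ∀ hν : ν ∈ Set.Ioo 0 ν₀, ∀ n : ℕ, (⌈K / ν⌉₊ : ℝ) ≤ n → ∀ 𝔸 : Torus.Visc4 (Fin 3),
    Torus.OddSmall 𝔸 (ν * β) → (∃ lam ∈ Set.Icc (1:ℝ) Λ, Torus.NearIso 𝔸 (ν * (lo / lam)) (ν * (hi * lam))) →
    Torus.OddSmall (Φ ν ((1 / ν) • 𝔸)) β → (∃ lam ∈ Set.Icc (1:ℝ) Λ, Torus.NearIso (Φ ν ((1 / ν) • 𝔸)) (lo / lam) (hi * lam)) →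
    ∀ θ ∈ Set.Icc 0 θ₁, ∀ nC : ℝ, 0 ≤ nC → nC ≤ ϱ₁ * n → ∀ Tw > (0:ℝ),
    ∀ G : ℝ → UnitAddTorus (Fin 3) → Matrix (Fin 3) (Fin 3) ℝ, IsFrameModulation θ Tw nC G →
    ∀ U T : ℝ → ℝ → (V2 →L[ℝ] V2),
      IsDistortedPropagator Tw ((1 / (n:ℝ) ^ 2) • 𝔸) (cellField W M hM ν hν.1 n) G U →
      IsDistortedPropagator Tw ((1 / (n:ℝ) ^ 2) • (𝔸 + (c / ν) • Φ ν ((1 / ν) • 𝔸))) (fun _ _ => 0) G T →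
    ∀ t : ℝ, 0 < t → t ≤ Tw → ∀ x ζ : V2,
      |⟪U 0 t x - T 0 t x, ζ⟫_ℝ|
        ≤ (C * (C * (ν ^ σ + ((⌈K / ν⌉₊ : ℝ) / n) ^ σ + θ ^ σ + (nC / n) ^ σ) + (min 1 ((M * W.period / ν) / t)) ^ σ))
          * Real.sqrt (lossFwd (T 0 t) x) * Real.sqrt (lossAdj (T 0 t) ζ)

/-- **The distorted block shape over the class of record** — `BlockBoundG` VERBATIM except `IsModulation ↦ IsFrameModulation`. -/
def BlockBoundGF {k : ℕ} (W : LatticeShear.LatticeWord k) (M : ℝ) (hM : 0 < M) (c : ℝ)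
    (Φ : ℝ → Torus.Visc4 (Fin 3) → Torus.Visc4 (Fin 3)) (lo hi Λ β σ Cb ν₀ K θ₁ ϱ₁ : ℝ) (Px Pζ : ℕ → V2 → Prop) : Prop :=
  ∀ ν, ∀ hν : ν ∈ Set.Ioo 0 ν₀, ∀ n : ℕ, (⌈K / ν⌉₊ : ℝ) ≤ n → ∀ 𝔸 : Torus.Visc4 (Fin 3),
    Torus.OddSmall 𝔸 (ν * β) → (∃ lam ∈ Set.Icc (1:ℝ) Λ, Torus.NearIso 𝔸 (ν * (lo / lam)) (ν * (hi * lam))) →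
    Torus.OddSmall (Φ ν ((1 / ν) • 𝔸)) β → (∃ lam ∈ Set.Icc (1:ℝ) Λ, Torus.NearIso (Φ ν ((1 / ν) • 𝔸)) (lo / lam) (hi * lam)) →
    ∀ θ ∈ Set.Icc 0 θ₁, ∀ nC : ℝ, 0 ≤ nC → nC ≤ ϱ₁ * n → ∀ Tw > (0:ℝ),
    ∀ G : ℝ → UnitAddTorus (Fin 3) → Matrix (Fin 3) (Fin 3) ℝ, IsFrameModulation θ Tw nC G →
    ∀ U T : ℝ → ℝ → (V2 →L[ℝ] V2),
      IsDistortedPropagator Tw ((1 / (n:ℝ) ^ 2) • 𝔸) (cellField W M hM ν hν.1 n) G U →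
      IsDistortedPropagator Tw ((1 / (n:ℝ) ^ 2) • (𝔸 + (c / ν) • Φ ν ((1 / ν) • 𝔸))) (fun _ _ => 0) G T →
    ∀ t : ℝ, 0 < t → t ≤ Tw → ∀ x ζ : V2, Px n x → Pζ n ζ →
      |⟪U 0 t x - T 0 t x, ζ⟫_ℝ|
        ≤ (Cb * (Cb * (ν ^ σ + ((⌈K / ν⌉₊ : ℝ) / n) ^ σ + θ ^ σ + (nC / n) ^ σ) + (min 1 ((M * W.period / ν) / t)) ^ σ))
          * Real.sqrt (lossFwd (T 0 t) x) * Real.sqrt (lossAdj (T 0 t) ζ)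

/-- **(M_θ) over the class of record** — `NearMultG` VERBATIM except `IsModulation ↦ IsFrameModulation` (REINSTATED by D28-8′: for holonomic data the
form-level constant is `κ_gen = η/(1−η)`, `η = (hi_f Λ²/lo)·ε(2+ε)`, `ε = ‖G−1‖_op ≤ 3θ`, after transverse canonicalisation of the coarse tensor; certifier toy
`κ ≈ θ₁/2` n-uniform). -/
def NearMultGF (c : ℝ) (Φ : ℝ → Torus.Visc4 (Fin 3) → Torus.Visc4 (Fin 3)) (lo hi Λ β ν₀ K θ₁ ϱ₁ κ : ℝ) : Prop :=
  ∀ ν : ℝ, ν ∈ Set.Ioo 0 ν₀ → ∀ n : ℕ, (⌈K / ν⌉₊ : ℝ) ≤ n → ∀ 𝔸 : Torus.Visc4 (Fin 3),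
    Torus.OddSmall 𝔸 (ν * β) → (∃ lam ∈ Set.Icc (1:ℝ) Λ, Torus.NearIso 𝔸 (ν * (lo / lam)) (ν * (hi * lam))) →
    Torus.OddSmall (Φ ν ((1 / ν) • 𝔸)) β → (∃ lam ∈ Set.Icc (1:ℝ) Λ, Torus.NearIso (Φ ν ((1 / ν) • 𝔸)) (lo / lam) (hi * lam)) →
    ∀ θ ∈ Set.Icc 0 θ₁, ∀ nC : ℝ, 0 ≤ nC → nC ≤ ϱ₁ * n → ∀ Tw > (0:ℝ),
    ∀ G : ℝ → UnitAddTorus (Fin 3) → Matrix (Fin 3) (Fin 3) ℝ, IsFrameModulation θ Tw nC G →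
    ∀ T : ℝ → ℝ → (V2 →L[ℝ] V2),
      IsDistortedPropagator Tw ((1 / (n:ℝ) ^ 2) • (𝔸 + (c / ν) • Φ ν ((1 / ν) • 𝔸))) (fun _ _ => 0) G T →
    ∀ t : ℝ, 0 < t → t ≤ Tw →
      (∀ xs xf : V2, IsSlow n xs → IsFast n xf →
        |⟪T 0 t xs, T 0 t xf⟫_ℝ| ≤ κ * Real.sqrt (lossFwd (T 0 t) xs) * Real.sqrt (lossFwd (T 0 t) xf)) ∧
      (∀ ζs ζf : V2, IsSlow n ζs → IsFast n ζf →
        |⟪ContinuousLinearMap.adjoint (T 0 t) ζs, ContinuousLinearMap.adjoint (T 0 t) ζf⟫_ℝ|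
          ≤ κ * Real.sqrt (lossAdj (T 0 t) ζs) * Real.sqrt (lossAdj (T 0 t) ζf))

/-- Weakening: the landed `SlowVectorClauseModECW0` implies the F-text (the F-class is smaller). -/
theorem modECW0F_of_modECW0 {k : ℕ} {W : LatticeShear.LatticeWord k} {M : ℝ} {hM : 0 < M} {c : ℝ}
    {Φ : ℝ → Torus.Visc4 (Fin 3) → Torus.Visc4 (Fin 3)} {lo hi Λ β σ C ν₀ K θ₁ ϱ₁ : ℝ}
    (h : SlowVectorClauseModECW0 W M hM c Φ lo hi Λ β σ C ν₀ K θ₁ ϱ₁) : SlowVectorClauseModECW0F W M hM c Φ lo hi Λ β σ C ν₀ K θ₁ ϱ₁ :=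
  fun ν hν n hn 𝔸 hodd hwin hΦo hΦw θ hθ nC hnC0 hnC Tw hTw G hG U T hU hT =>
    h ν hν n hn 𝔸 hodd hwin hΦo hΦw θ hθ nC hnC0 hnC Tw hTw G hG.toIsModulation U T hU hT

/-- Weakening for the blocks. -/
theorem blockBoundGF_of_blockBoundG {k : ℕ} {W : LatticeShear.LatticeWord k} {M : ℝ} {hM : 0 < M} {c : ℝ}
    {Φ : ℝ → Torus.Visc4 (Fin 3) → Torus.Visc4 (Fin 3)} {lo hi Λ β σ Cb ν₀ K θ₁ ϱ₁ : ℝ} {Px Pζ : ℕ → V2 → Prop}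
    (h : BlockBoundG W M hM c Φ lo hi Λ β σ Cb ν₀ K θ₁ ϱ₁ Px Pζ) : BlockBoundGF W M hM c Φ lo hi Λ β σ Cb ν₀ K θ₁ ϱ₁ Px Pζ :=
  fun ν hν n hn 𝔸 hodd hwin hΦo hΦw θ hθ nC hnC0 hnC Tw hTw G hG U T hU hT =>
    h ν hν n hn 𝔸 hodd hwin hΦo hΦw θ hθ nC hnC0 hnC Tw hTw G hG.toIsModulation U T hU hT

/-- Weakening for (M_θ). -/
theorem nearMultGF_of_nearMultG {c : ℝ} {Φ : ℝ → Torus.Visc4 (Fin 3) → Torus.Visc4 (Fin 3)} {lo hi Λ β ν₀ K θ₁ ϱ₁ κ : ℝ}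
    (h : NearMultG c Φ lo hi Λ β ν₀ K θ₁ ϱ₁ κ) : NearMultGF c Φ lo hi Λ β ν₀ K θ₁ ϱ₁ κ :=
  fun ν hν n hn 𝔸 hodd hwin hΦo hΦw θ hθ nC hnC0 hnC Tw hTw G hG T hT =>
    h ν hν n hn 𝔸 hodd hwin hΦo hΦw θ hθ nC hnC0 hnC Tw hTw G hG.toIsModulation T hT

end Summit.AnomalousDissipation.AnomalousDissipation.Theorems.SolenoidalFractalHomogenisation.LagrangianStep.VmodDist
/-! ## §3 `FrameConjugacyAtF` -/

namespace Summit.AnomalousDissipation.AnomalousDissipation.Theorems.SolenoidalFractalHomogenisation.LagrangianStep.Z7Glue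

open Literature.Analysis Literature.Analysis.FluidPDE Literature.Analysis.FunctionSpaces
open MeasureTheory Set
open scoped InnerProductSpace
open Literature.Analysis.FluidPDE.LatticeShear (LagrangianLatticeCarrier LatticeWord)
open Summit.AnomalousDissipation.AnomalousDissipation.Theorems.SolenoidalFractalHomogenisation.LagrangianStep.CellClauseMod

/-- **`FrameConjugacyAtF`** — `FrameConjugacyAt` (p694968) VERBATIM except that the hidden modulation datum is a FRAME modulation
(`IsFrameModulation`: clamped · rate · holonomic). -/
def FrameConjugacyAtF {k : ℕ} (W : LatticeWord k) (M : ℝ) (hM : 0 < M) (c : ℝ) (Φ : ℝ → Torus.Visc4 (Fin 3) → Torus.Visc4 (Fin 3))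
    (Cα ϱ : ℝ) (E : LagrangianLatticeCarrier k) (m : ℕ) (S : Torus.Visc4 (Fin 3)) (Um1 Um : ℝ → ℝ → (V2 →L[ℝ] V2)) (s t : ℝ) : Prop :=
  ∃ hν : E.cellVisc (m + 1) ∈ Set.Ioo 0 (E.cellVisc (m + 1) + 1),
  ∃ θ : ℝ, 0 ≤ θ ∧ θ ≤ Cα * E.θ (m + 1) ∧ ∃ nC : ℝ, 0 ≤ nC ∧ nC ≤ ϱ * E.N m ∧
  ∃ G : ℝ → UnitAddTorus (Fin 3) → Matrix (Fin 3) (Fin 3) ℝ, IsFrameModulation θ (E.a (m + 1) * (t - s)) nC G ∧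
  ∃ Ut Tt : ℝ → ℝ → (V2 →L[ℝ] V2),
    IsDistortedPropagator (E.a (m + 1) * (t - s)) ((1 / (E.N (m + 1) : ℝ) ^ 2) • (E.cellVisc (m + 1) • S))
      (cellField W M hM (E.cellVisc (m + 1)) hν.1 (E.N (m + 1))) G Ut ∧
    IsDistortedPropagator (E.a (m + 1) * (t - s)) ((1 / (E.N (m + 1) : ℝ) ^ 2) • (E.cellVisc (m + 1) • S +
      (c / E.cellVisc (m + 1)) • Φ (E.cellVisc (m + 1)) ((1 / E.cellVisc (m + 1)) • (E.cellVisc (m + 1) • S)))) (fun _ _ => 0) G Tt ∧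
  ∃ ι ι' : V2 → V2,
    (∀ x y : V2, Torus.IsWeaklyDivFree (⇑x : VF) → Torus.IsWeaklyDivFree (⇑y : VF) →
      ⟪Um1 s t x - Um s t x, y⟫_ℝ
        = ⟪Ut 0 (E.a (m + 1) * (t - s)) (ι x) - Tt 0 (E.a (m + 1) * (t - s)) (ι x), ι' y⟫_ℝ) ∧
    (∀ x : V2, Torus.IsWeaklyDivFree (⇑x : VF) → lossFwd (Tt 0 (E.a (m + 1) * (t - s))) (ι x) = lossFwd (Um s t) x) ∧
    (∀ y : V2, Torus.IsWeaklyDivFree (⇑y : VF) → lossAdj (Tt 0 (E.a (m + 1) * (t - s))) (ι' y) = lossAdj (Um s t) y)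

/-- The F-conjugacy forgets to the landed one. -/
theorem FrameConjugacyAtF.toFrameConjugacyAt {k : ℕ} {W : LatticeWord k} {M : ℝ} {hM : 0 < M} {c : ℝ}
    {Φ : ℝ → Torus.Visc4 (Fin 3) → Torus.Visc4 (Fin 3)} {Cα ϱ : ℝ} {E : LagrangianLatticeCarrier k} {m : ℕ} {S : Torus.Visc4 (Fin 3)}
    {Um1 Um : ℝ → ℝ → (V2 →L[ℝ] V2)} {s t : ℝ} (h : FrameConjugacyAtF W M hM c Φ Cα ϱ E m S Um1 Um s t) :
    FrameConjugacyAt W M hM c Φ Cα ϱ E m S Um1 Um s t := by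
  obtain ⟨hν, θ, hθ0, hθle, nC, hnC0, hnCle, G, hG, Ut, Tt, hUt, hTt, ι, ι', hconj, hlossF, hlossA⟩ := h
  exact ⟨hν, θ, hθ0, hθle, nC, hnC0, hnCle, G, hG.toIsModulation, Ut, Tt, hUt, hTt, ι, ι', hconj, hlossF, hlossA⟩

end Summit.AnomalousDissipation.AnomalousDissipation.Theorems.SolenoidalFractalHomogenisation.LagrangianStep.Z7Glue


end
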